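import Literature.Geometry.Lorentzian.ConformalCoordCurvature
import Literature.Geometry.Lorentzian.CoordFlatBackground
import HarnessLib

/-!
# The constraint map of conformally flat data `(c δ, K)` in flat terms

Support file (everything proved; no definitions, no named facts) for the coordinate treatment of
initial data sets whose metric components are CONFORMALLY FLAT, `G_y = c(y) ⟪·, ·⟫` on an open set
`V` of a Euclidean space (`c` smooth and non-vanishing there), with an arbitrary field `K` of
symmetric bilinear forms (the second fundamental form). For such components the objects of the
coordinate tensor calculus `MetricCoord` (`CoordCurvature.lean` ff.) entering the constraint map
`Φ = (H, M)` (`MetricCoord.hamAt`, `MetricCoord.momFn`, the chart expressions of the constraint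
functions of the tree's `InitialDataSet`, `CoordConstraintBridge.lean`) are computed in terms of
FLAT derivatives, in an orthonormal basis `b`:

* `chrAt_conformal_innerSL` — `Γ_x(X, Y) = θ(X) Y + θ(Y) X − ⟪X, Y⟫ T`, `θ = dc/(2c)`, `T = θ♯`
  (Besse 1987, Thm. 1.159 (a), with the flat `Γ = 0`, `chrAt_innerSL`);
* `cov₂At_conformal_innerSL` — `(∇K)(W; Y, Z) = DK(W)(Y, Z) − K(C(W,Y), Z) − K(Y, C(W,Z))`;
* `ginv_conformal_innerSL`, `mtrAt_conformal_innerSL`, `normSqAt_conformal`,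
  `normSqAt_conformal_innerSL` — `g^{ij} = c⁻¹ δ^{ij}`, `tr_G K = c⁻¹ Σᵢ K(bᵢ,bᵢ)`,
  `|K|²_G = c⁻² Σᵢⱼ K(bᵢ,bⱼ)²`;
* **`momFn_conformal_innerSL`** — the momentum constraint map:
  `M(Z) = c⁻¹ ( Σₖ ∂_{bₖ} K(bₖ, Z) − ∂_Z Σᵢ K(bᵢ, bᵢ) + (n − 2) K(T, Z) + θ(Z) Σᵢ K(bᵢ, bᵢ) )`,
  i.e. for `c = ψ⁴`, `n = 3`: `M_j = ψ⁻⁴ (∂ᵢKᵢⱼ − ∂ⱼ tr K + 2ψ⁻¹ Kᵢⱼ ∂ᵢψ + 2ψ⁻¹ tr K ∂ⱼψ)`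
  (the standard conformal rescaling of the divergence of a symmetric two-tensor of conformal weight
  zero, Bartnik–Isenberg 2004, §4.1, cf. (4.5)–(4.7); here derived from Besse's formula for `Γ`);
* **`hamAt_conformal_fourth_power_innerSL`** — the Hamiltonian constraint density in dimension
  three for `c = ψ⁴`: `H = −8 ψ⁻⁵ Δψ − ψ⁻⁸ Σᵢⱼ K(bᵢ,bⱼ)² + ψ⁻⁸ (Σᵢ K(bᵢ,bᵢ))²` (Schoen–Yau 1979,
  p. 49: `R(ψ⁴δ) = −8ψ⁻⁵Δψ`, `IsMetricOn.scalAt_conformal_fourth_power` with the flat `S = 0`;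
  Bartnik–Isenberg 2004, (2.1) and §4.1, the identity behind the Lichnerowicz equation).

These are the formulas by which the vacuum constraints of an explicitly given conformally flat
datum are checked by flat calculus (e.g. Bowen–York / Brill–Lindquist type data, and the radial
constructions of `InteriorKerrGluing`-related files). Everything is proved; no `def`, no named fact.

## References

* A. L. Besse, *Einstein manifolds*, Springer 1987, Thm. 1.159. [Besse1987]
* R. Bartnik, J. Isenberg, *The constraint equations*, in: The Einstein equations and the large
  scale behavior of gravitational fields, Birkhäuser 2004, §2 (2.1)–(2.2), §4.1.
  [BartnikIsenberg2004]
* R. Schoen, S.-T. Yau, Comm. Math. Phys. 65 (1979) 45–76, §2 Step 1, p. 49. [SchoenYauPMT1979]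
* B. O'Neill, *Semi-Riemannian geometry*, Academic Press 1983, Ch. 2, Prop. 2.13; Ch. 3,
  Prop. 3.13, pp. 60–61, p. 86. [ONeill1983]
-/

noncomputable section

-- nested operator spaces `E →L E →L E →L ℝ`, as in the `MetricCoord` files
set_option maxSynthPendingDepth 3

open scoped RealInnerProductSpace
open Set Filter
open scoped Topology ContDiff

namespace Literature.Geometry.Lorentzian

namespace MetricCoord

variable {E : Type*} [NormedAddCommGroup E] [InnerProductSpace ℝ E] [FiniteDimensional ℝ E]

/-! ### The flat background on an open set -/

/-- The flat components are metric components on every open set.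
[cite: ONeill1983, Ch. 3, Def. 3.1] -/
theorem isMetricOn_innerSL {V : Set E} (hV : IsOpen V) : IsMetricOn (fun _ : E ↦ innerSL ℝ) V where
  isOpen := hV
  contDiffOn := contDiffOn_const
  symm _ _ v w := by
    show ⟪v, w⟫ = ⟪w, v⟫
    exact real_inner_comm w v
  isInvertible x _ := isInvertible_innerSL x

omit [FiniteDimensional ℝ E] in
/-- In an orthonormal basis `v = Σᵢ ⟪v, bᵢ⟫ bᵢ`. [cite: ONeill1983, Ch. 2, Lemma 2.25] -/
theorem sum_inner_smul_of_orthonormal {ι : Type*} [Fintype ι] [DecidableEq ι]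
    (b : Module.Basis ι ℝ E) (hb : Orthonormal ℝ b) (v : E) : ∑ i, ⟪v, b i⟫ • b i = v :=
  sum_apply_smul_of_orthonormal (G := (fun _ : E ↦ innerSL ℝ)) (x := v) b
    (fun i j ↦ (orthonormal_iff_ite.1 hb) i j) v

/-- The conformal vector field of `c δ` is the Riesz vector of `θ = dc/(2c)`: `⟪T, w⟫ = θ(w)`.
[cite: Besse1987, Thm. 1.159] -/
theorem inner_confVec_innerSL (c : E → ℝ) (x w : E) :
    ⟪confVec (fun _ : E ↦ innerSL ℝ) c x, w⟫ = confForm c x w :=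
  inner_sharpAt_innerSL x (confForm c x) w

/-- `Σₖ θ(bₖ) bₖ = T` in an orthonormal basis. [folklore] -/
theorem sum_confForm_smul_eq_confVec {ι : Type*} [Fintype ι] [DecidableEq ι]
    (b : Module.Basis ι ℝ E) (hb : Orthonormal ℝ b) (c : E → ℝ) (x : E) :
    ∑ k, confForm c x (b k) • b k = confVec (fun _ : E ↦ innerSL ℝ) c x := by
  conv_rhs => rw [← sum_inner_smul_of_orthonormal b hb (confVec (fun _ : E ↦ innerSL ℝ) c x)]
  exact Finset.sum_congr rfl fun k _ ↦ by rw [inner_confVec_innerSL]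

/-! ### Christoffel symbols and covariant derivative of the conformally flat components -/

section Conformal

variable {V : Set E} {x : E} {c : E → ℝ}

/-- The conformally flat components `y ↦ c(y) δ` are metric components on `V` when `c` is smooth
and non-vanishing there. [cite: Besse1987, Thm. 1.159] -/
theorem isMetricOn_conformal_innerSL (hV : IsOpen V) (hc : ContDiffOn ℝ ∞ c V)
    (hc0 : ∀ y ∈ V, c y ≠ 0) :
    IsMetricOn (fun y ↦ c y • (innerSL ℝ : E →L[ℝ] E →L[ℝ] ℝ)) V :=
  isMetricOn_conformal (isMetricOn_innerSL hV) hc hc0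

omit [FiniteDimensional ℝ E] in
/-- **The difference tensor of `c δ`**: `C_x(X, Y) = θ(X) Y + θ(Y) X − ⟪X, Y⟫ T`.
[cite: Besse1987, Thm. 1.159 (a)] -/
theorem confDiff_innerSL (c : E → ℝ) (x X Y : E) :
    confDiff (fun _ : E ↦ innerSL ℝ) c x X Y =
      confForm c x X • Y + confForm c x Y • X - ⟪X, Y⟫ • confVec (fun _ : E ↦ innerSL ℝ) c x :=
  rfl

/-- **The Christoffel map of conformally flat components** (Besse 1987, Thm. 1.159 (a) with the
flat `Γ = 0`): `Γ_x(X, Y) = θ(X) Y + θ(Y) X − ⟪X, Y⟫ T`, `θ = dc/(2c)`, `T = θ♯`.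
[cite: Besse1987, Thm. 1.159 (a)] -/
theorem chrAt_conformal_innerSL (hV : IsOpen V) (hc : ContDiffOn ℝ ∞ c V) (hc0 : ∀ y ∈ V, c y ≠ 0)
    (hx : x ∈ V) (X Y : E) :
    chrAt (fun y ↦ c y • (innerSL ℝ : E →L[ℝ] E →L[ℝ] ℝ)) x X Y =
      confForm c x X • Y + confForm c x Y • X - ⟪X, Y⟫ • confVec (fun _ : E ↦ innerSL ℝ) c x := by
  rw [(isMetricOn_innerSL hV).chrAt_conformal_eq hc hc0 hx, chrAt_innerSL]
  simp only [_root_.zero_apply, zero_add]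
  rfl

/-- **The covariant derivative of a field of bilinear forms for conformally flat components**:
`(∇K)_x(W; Y, Z) = DK(x)(W)(Y, Z) − K(C(W,Y), Z) − K(Y, C(W,Z))`.
[cite: ONeill1983, Ch. 2, Prop. 2.13] -/
theorem cov₂At_conformal_innerSL (hV : IsOpen V) (hc : ContDiffOn ℝ ∞ c V)
    (hc0 : ∀ y ∈ V, c y ≠ 0) (hx : x ∈ V) (K : E → E →L[ℝ] E →L[ℝ] ℝ) (W Y Z : E) :
    cov₂At (fun y ↦ c y • (innerSL ℝ : E →L[ℝ] E →L[ℝ] ℝ)) K x W Y Z =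
      fderiv ℝ K x W Y Z - K x (confDiff (fun _ : E ↦ innerSL ℝ) c x W Y) Z
        - K x Y (confDiff (fun _ : E ↦ innerSL ℝ) c x W Z) := by
  rw [cov₂At_apply, chrAt_conformal_innerSL hV hc hc0 hx, chrAt_conformal_innerSL hV hc hc0 hx,
    confDiff_innerSL, confDiff_innerSL]

/-! ### Inverse metric, trace and square norm -/

/-- **`g^{ij} = c⁻¹ δ^{ij}`** for conformally flat components in an orthonormal basis.
[cite: ONeill1983, Ch. 3, p. 60] -/
theorem ginv_conformal_innerSL {ι : Type*} [Fintype ι] [DecidableEq ι] (hV : IsOpen V)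
    (hc : ContDiffOn ℝ ∞ c V) (hc0 : ∀ y ∈ V, c y ≠ 0) (hx : x ∈ V) (b : Module.Basis ι ℝ E)
    (hb : Orthonormal ℝ b) (i j : ι) :
    ginv (fun y ↦ c y • (innerSL ℝ : E →L[ℝ] E →L[ℝ] ℝ)) b x i j =
      (c x)⁻¹ * if i = j then 1 else 0 := by
  have hx' := (isMetricOn_conformal_innerSL hV hc hc0).isInvertible x hx
  rw [ginv, sharpAt_conformal (isInvertible_innerSL x) hx' (hc0 x hx), map_smul, smul_eq_mul]
  congr 1
  exact ginv_innerSL b hb x i j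

/-- **`tr_{cδ} β = c⁻¹ Σᵢ β(bᵢ, bᵢ)`** in an orthonormal basis.
[cite: ONeill1983, Ch. 3, pp. 60–61] -/
theorem mtrAt_conformal_innerSL {ι : Type*} [Fintype ι] [DecidableEq ι] (hV : IsOpen V)
    (hc : ContDiffOn ℝ ∞ c V) (hc0 : ∀ y ∈ V, c y ≠ 0) (hx : x ∈ V) (b : Module.Basis ι ℝ E)
    (hb : Orthonormal ℝ b) (β : E →L[ℝ] E →L[ℝ] ℝ) :
    mtrAt (fun y ↦ c y • (innerSL ℝ : E →L[ℝ] E →L[ℝ] ℝ)) x β = (c x)⁻¹ * ∑ i, β (b i) (b i) := by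
  have hx' := (isMetricOn_conformal_innerSL hV hc hc0).isInvertible x hx
  rw [mtrAt_conformal (isInvertible_innerSL x) hx' (hc0 x hx), mtrAt_innerSL b hb]

omit [FiniteDimensional ℝ E] in
/-- **`|β|²_{cG} = c⁻² |β|²_G`**: the metric square norm under a conformal change of arbitrary
metric components (`♯' = c⁻¹ ♯`). [cite: Besse1987, Thm. 1.159] -/
theorem normSqAt_conformal {F : Type*} [NormedAddCommGroup F] [NormedSpace ℝ F]
    {G : F → F →L[ℝ] F →L[ℝ] ℝ} {x : F} {c : F → ℝ}
    (hx : (G x).IsInvertible) (hx' : ((fun y ↦ c y • G y) x).IsInvertible) (hcx : c x ≠ 0)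
    (β : F →L[ℝ] F →L[ℝ] ℝ) :
    normSqAt (fun y ↦ c y • G y) x β = (c x)⁻¹ ^ 2 * normSqAt G x β := by
  have h1 : (sharpAt (fun y ↦ c y • G y) x).comp β = (c x)⁻¹ • (sharpAt G x).comp β := by
    ext v
    simp only [ContinuousLinearMap.comp_apply, _root_.smul_apply,
      sharpAt_conformal hx hx' hcx]
  have h2 : (sharpAt (fun y ↦ c y • G y) x).comp β.flip = (c x)⁻¹ • (sharpAt G x).comp β.flip := by
    ext v
    simp only [ContinuousLinearMap.comp_apply, _root_.smul_apply,
      sharpAt_conformal hx hx' hcx]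
  rw [normSqAt, h1, h2, ContinuousLinearMap.smul_comp, ContinuousLinearMap.comp_smul, smul_smul,
    ContinuousLinearMap.toLinearMap_smul, map_smul, smul_eq_mul, sq, normSqAt]

/-- **`|β|²_δ = Σᵢⱼ β(bᵢ, bⱼ)²`** in an orthonormal basis (`|β|² = tr ((♯β)(♯βᵗ))`,
`♯` the Riesz identification). [cite: ONeill1983, Ch. 3, pp. 60–61] -/
theorem normSqAt_innerSL {ι : Type*} [Fintype ι] [DecidableEq ι] (b : Module.Basis ι ℝ E)
    (hb : Orthonormal ℝ b) (x : E) (β : E →L[ℝ] E →L[ℝ] ℝ) :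
    normSqAt (fun _ : E ↦ innerSL ℝ) x β = ∑ i, ∑ j, β (b i) (b j) ^ 2 := by
  have he : ∀ i j, ((fun _ : E ↦ innerSL ℝ) x) (b i) (b j) = if i = j then (1 : ℝ) else 0 :=
    fun i j ↦ (orthonormal_iff_ite.1 hb) i j
  rw [normSqAt, trace_eq_sum_coord b, Finset.sum_comm]
  refine Finset.sum_congr rfl fun i _ ↦ ?_
  set u : E := sharpAt (fun _ : E ↦ innerSL ℝ) x (β.flip (b i)) with hu
  have hexp : u = ∑ j, β (b j) (b i) • b j := by
    conv_lhs => rw [← sum_inner_smul_of_orthonormal b hb u]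
    refine Finset.sum_congr rfl fun j _ ↦ ?_
    rw [hu, inner_sharpAt_innerSL, ContinuousLinearMap.flip_apply]
  have hcoord : b.coord i (sharpAt (fun _ : E ↦ innerSL ℝ) x (β u)) = β u (b i) := by
    rw [coord_eq_apply_of_orthonormal (G := (fun _ : E ↦ innerSL ℝ)) (x := x) b he]
    exact inner_sharpAt_innerSL x (β u) (b i)
  calc b.coord i ((((sharpAt (fun _ : E ↦ innerSL ℝ) x).comp β).comp
        ((sharpAt (fun _ : E ↦ innerSL ℝ) x).comp β.flip) : E →L[ℝ] E) (b i))
      = β u (b i) := by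
        simpa only [ContinuousLinearMap.coe_coe, ContinuousLinearMap.comp_apply] using hcoord
    _ = ∑ j, β (b j) (b i) ^ 2 := by
        rw [hexp]
        simp only [map_sum, map_smul, _root_.sum_apply,
          _root_.smul_apply, smul_eq_mul, sq]

/-- **`|β|²_{cδ} = c⁻² Σᵢⱼ β(bᵢ, bⱼ)²`** in an orthonormal basis.
[cite: ONeill1983, Ch. 3, pp. 60–61] -/
theorem normSqAt_conformal_innerSL {ι : Type*} [Fintype ι] [DecidableEq ι] (hV : IsOpen V)
    (hc : ContDiffOn ℝ ∞ c V) (hc0 : ∀ y ∈ V, c y ≠ 0) (hx : x ∈ V) (b : Module.Basis ι ℝ E)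
    (hb : Orthonormal ℝ b) (β : E →L[ℝ] E →L[ℝ] ℝ) :
    normSqAt (fun y ↦ c y • (innerSL ℝ : E →L[ℝ] E →L[ℝ] ℝ)) x β =
      (c x)⁻¹ ^ 2 * ∑ i, ∑ j, β (b i) (b j) ^ 2 := by
  have hx' := (isMetricOn_conformal_innerSL hV hc hc0).isInvertible x hx
  rw [normSqAt_conformal (isInvertible_innerSL x) hx' (hc0 x hx), normSqAt_innerSL b hb x β]

/-! ### The momentum constraint map -/

/-- The two Christoffel contractions entering `div_{cδ} K` in an orthonormal basis:
`Σₖ K(C(bₖ,bₖ), Z) = (2 − n) K(T, Z)`. [cite: Besse1987, Thm. 1.159 (a)] -/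
theorem sum_apply_confDiff_self {ι : Type*} [Fintype ι] [DecidableEq ι] (b : Module.Basis ι ℝ E)
    (hb : Orthonormal ℝ b) (c : E → ℝ) (x : E) (K : E →L[ℝ] E →L[ℝ] ℝ) (Z : E) :
    ∑ k, K (confDiff (fun _ : E ↦ innerSL ℝ) c x (b k) (b k)) Z =
      (2 - Fintype.card ι : ℝ) * K (confVec (fun _ : E ↦ innerSL ℝ) c x) Z := by
  have hkk : ∀ k, ⟪b k, b k⟫ = (1 : ℝ) := fun k ↦ by
    rw [(orthonormal_iff_ite.1 hb) k k, if_pos rfl]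
  simp only [confDiff_innerSL, hkk, one_smul, map_sub, map_add, map_smul,
    _root_.sub_apply, _root_.add_apply, _root_.smul_apply,
    smul_eq_mul, Finset.sum_sub_distrib, Finset.sum_add_distrib, Finset.sum_const, Finset.card_univ,
    nsmul_eq_mul]
  have hT : ∑ k, confForm c x (b k) * K (b k) Z = K (confVec (fun _ : E ↦ innerSL ℝ) c x) Z := by
    have h := congrArg (fun v ↦ K v Z) (sum_confForm_smul_eq_confVec b hb c x)
    simpa only [map_sum, map_smul, _root_.sum_apply, _root_.smul_apply,
      smul_eq_mul] using h
  rw [hT]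
  ring

/-- `Σₖ K(bₖ, C(bₖ, Z)) = θ(Z) Σₖ K(bₖ, bₖ)` for a symmetric `K`.
[cite: Besse1987, Thm. 1.159 (a)] -/
theorem sum_apply_confDiff {ι : Type*} [Fintype ι] [DecidableEq ι] (b : Module.Basis ι ℝ E)
    (hb : Orthonormal ℝ b) (c : E → ℝ) (x : E) {K : E →L[ℝ] E →L[ℝ] ℝ} (hK : ∀ v w, K v w = K w v)
    (Z : E) :
    ∑ k, K (b k) (confDiff (fun _ : E ↦ innerSL ℝ) c x (b k) Z) =
      confForm c x Z * ∑ k, K (b k) (b k) := by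
  simp only [confDiff_innerSL, map_sub, map_add, map_smul, smul_eq_mul, Finset.sum_sub_distrib,
    Finset.sum_add_distrib, ← Finset.mul_sum]
  -- `Σ θ(bₖ) K(bₖ, Z) = K(T, Z)` and `Σ ⟪bₖ, Z⟫ K(bₖ, T) = K(Z, T)`
  have h1 : ∑ k, confForm c x (b k) * K (b k) Z = K (confVec (fun _ : E ↦ innerSL ℝ) c x) Z := by
    have h := congrArg (fun v ↦ K v Z) (sum_confForm_smul_eq_confVec b hb c x)
    simpa only [map_sum, map_smul, _root_.sum_apply, _root_.smul_apply,
      smul_eq_mul] using h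
  have h2 : ∑ k, ⟪b k, Z⟫ * K (b k) (confVec (fun _ : E ↦ innerSL ℝ) c x) =
      K Z (confVec (fun _ : E ↦ innerSL ℝ) c x) := by
    have h := congrArg (fun v ↦ K v (confVec (fun _ : E ↦ innerSL ℝ) c x))
      (sum_inner_smul_of_orthonormal b hb Z)
    simp only [map_sum, map_smul, _root_.sum_apply, _root_.smul_apply,
      smul_eq_mul] at h
    rw [← h]
    exact Finset.sum_congr rfl fun k _ ↦ by rw [real_inner_comm]
  rw [h1, h2, hK Z]
  ring

/-- Near a point of `V` the metric trace of `K` for `c δ` is `c⁻¹ Σᵢ K(bᵢ, bᵢ)`. [folklore] -/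
theorem mtrAt_conformal_innerSL_eventuallyEq {ι : Type*} [Fintype ι] [DecidableEq ι]
    (hV : IsOpen V) (hc : ContDiffOn ℝ ∞ c V) (hc0 : ∀ y ∈ V, c y ≠ 0) (hx : x ∈ V)
    (b : Module.Basis ι ℝ E) (hb : Orthonormal ℝ b) (K : E → E →L[ℝ] E →L[ℝ] ℝ) :
    (fun y ↦ mtrAt (fun y ↦ c y • (innerSL ℝ : E →L[ℝ] E →L[ℝ] ℝ)) y (K y)) =ᶠ[𝓝 x]
      fun y ↦ (c y)⁻¹ * ∑ i, K y (b i) (b i) := by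
  filter_upwards [hV.mem_nhds hx] with y hy
  exact mtrAt_conformal_innerSL hV hc hc0 hy b hb (K y)

omit [FiniteDimensional ℝ E] in
/-- The derivative of `y ↦ Σᵢ K_y(bᵢ, bᵢ)`. [folklore] -/
theorem hasFDerivAt_sum_apply_self {ι : Type*} [Fintype ι] (b : Module.Basis ι ℝ E)
    {K : E → E →L[ℝ] E →L[ℝ] ℝ} (hK : DifferentiableAt ℝ K x) :
    HasFDerivAt (fun y ↦ ∑ i, K y (b i) (b i))
      (∑ i, (ContinuousLinearMap.apply ℝ ℝ (b i)).comp
        ((ContinuousLinearMap.apply ℝ (E →L[ℝ] ℝ) (b i)).comp (fderiv ℝ K x))) x := by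
  refine HasFDerivAt.fun_sum fun i _ ↦ ?_
  have h1 : HasFDerivAt (fun y ↦ K y (b i))
      ((ContinuousLinearMap.apply ℝ (E →L[ℝ] ℝ) (b i)).comp (fderiv ℝ K x)) x :=
    (ContinuousLinearMap.apply ℝ (E →L[ℝ] ℝ) (b i)).hasFDerivAt.comp x hK.hasFDerivAt
  exact (ContinuousLinearMap.apply ℝ ℝ (b i)).hasFDerivAt.comp x h1

omit [FiniteDimensional ℝ E] in
/-- `∂_Z Σᵢ K(bᵢ, bᵢ) = Σᵢ DK(x)(Z)(bᵢ, bᵢ)`. [folklore] -/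
theorem fderiv_sum_apply_self {ι : Type*} [Fintype ι] (b : Module.Basis ι ℝ E)
    {K : E → E →L[ℝ] E →L[ℝ] ℝ} (hK : DifferentiableAt ℝ K x) (Z : E) :
    fderiv ℝ (fun y ↦ ∑ i, K y (b i) (b i)) x Z = ∑ i, fderiv ℝ K x Z (b i) (b i) := by
  rw [(hasFDerivAt_sum_apply_self b hK).fderiv]
  simp only [_root_.sum_apply, ContinuousLinearMap.comp_apply,
    ContinuousLinearMap.apply_apply]

/-- **The momentum constraint map of conformally flat data.** For `G = c δ` on the open set `V`
(`c` smooth, non-vanishing), a field `K` of bilinear forms differentiable at `x ∈ V` with `K_x`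
symmetric, and an orthonormal basis `b` of the `n`-dimensional space:
`M(Z) = c(x)⁻¹ ( [Σₖ ∂_{bₖ}K(bₖ, Z) − ∂_Z Σᵢ K(bᵢ, bᵢ)] + (n − 2) K(T, Z) + θ(Z) Σᵢ K(bᵢ, bᵢ) )`,
with `θ = dc/(2c)`, `T = θ♯`; the bracket is the flat momentum constraint map `momFn b δ K x Z`
(`momFn_innerSL`). (Bartnik–Isenberg 2004, §4.1: conformal rescaling of `div K − d tr K`; derived
here from Besse 1987, Thm. 1.159 (a).) [cite: BartnikIsenberg2004, §4.1] -/
theorem momFn_conformal_innerSL {ι : Type*} [Fintype ι] [DecidableEq ι] (hV : IsOpen V)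
    (hc : ContDiffOn ℝ ∞ c V) (hc0 : ∀ y ∈ V, c y ≠ 0) (hx : x ∈ V) (b : Module.Basis ι ℝ E)
    (hb : Orthonormal ℝ b) {K : E → E →L[ℝ] E →L[ℝ] ℝ} (hK : DifferentiableAt ℝ K x)
    (hKs : ∀ v w, K x v w = K x w v) (Z : E) :
    momFn b (fun y ↦ c y • (innerSL ℝ : E →L[ℝ] E →L[ℝ] ℝ)) K x Z =
      (c x)⁻¹ * ((∑ k, fderiv ℝ K x (b k) (b k) Z - ∑ i, fderiv ℝ K x Z (b i) (b i))
        + (Fintype.card ι - 2 : ℝ) * K x (confVec (fun _ : E ↦ innerSL ℝ) c x) Z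
        + confForm c x Z * ∑ i, K x (b i) (b i)) := by
  have hcx := hc0 x hx
  have hcd : DifferentiableAt ℝ c x :=
    ((hc x hx).contDiffAt (hV.mem_nhds hx)).differentiableAt (by simp)
  -- the trace term
  have htr : fderiv ℝ (fun y ↦ mtrAt (fun y ↦ c y • (innerSL ℝ : E →L[ℝ] E →L[ℝ] ℝ)) y (K y)) x Z =
      -((c x)⁻¹ * (2 * confForm c x Z)) * (∑ i, K x (b i) (b i))
        + (c x)⁻¹ * ∑ i, fderiv ℝ K x Z (b i) (b i) := by
    rw [(mtrAt_conformal_innerSL_eventuallyEq hV hc hc0 hx b hb K).fderiv_eq]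
    have hinv : HasFDerivAt (fun y ↦ (c y)⁻¹) (-((c x) ^ 2)⁻¹ • fderiv ℝ c x) x :=
      (hasDerivAt_inv hcx).comp_hasFDerivAt x hcd.hasFDerivAt
    rw [(hinv.fun_mul (hasFDerivAt_sum_apply_self b hK)).fderiv]
    simp only [_root_.add_apply, _root_.smul_apply, smul_eq_mul,
      _root_.sum_apply, ContinuousLinearMap.comp_apply,
      ContinuousLinearMap.apply_apply, confForm_apply]
    field_simp
    ring
  have hsum : ∑ k, ∑ l, ginv (fun y ↦ c y • (innerSL ℝ : E →L[ℝ] E →L[ℝ] ℝ)) b x k l *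
      cov₂At (fun y ↦ c y • (innerSL ℝ : E →L[ℝ] E →L[ℝ] ℝ)) K x (b k) (b l) Z =
      (c x)⁻¹ * ((∑ k, fderiv ℝ K x (b k) (b k) Z)
        - (2 - Fintype.card ι : ℝ) * K x (confVec (fun _ : E ↦ innerSL ℝ) c x) Z
        - confForm c x Z * ∑ k, K x (b k) (b k)) := by
    have hdiag : ∀ k, ∑ l, ginv (fun y ↦ c y • (innerSL ℝ : E →L[ℝ] E →L[ℝ] ℝ)) b x k l *
        cov₂At (fun y ↦ c y • (innerSL ℝ : E →L[ℝ] E →L[ℝ] ℝ)) K x (b k) (b l) Z =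
        (c x)⁻¹ * cov₂At (fun y ↦ c y • (innerSL ℝ : E →L[ℝ] E →L[ℝ] ℝ)) K x (b k) (b k) Z := by
      intro k
      simp only [ginv_conformal_innerSL hV hc hc0 hx b hb, mul_ite, mul_one, mul_zero, ite_mul,
        zero_mul, Finset.sum_ite_eq, Finset.mem_univ, if_true]
    rw [Finset.sum_congr rfl fun k _ ↦ hdiag k, ← Finset.mul_sum]
    simp only [cov₂At_conformal_innerSL hV hc hc0 hx]
    rw [Finset.sum_sub_distrib, Finset.sum_sub_distrib, sum_apply_confDiff_self b hb c x (K x) Z,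
      sum_apply_confDiff b hb c x hKs Z]
  rw [momFn_eq, htr, hsum]
  ring

/-- **The momentum constraint map of conformally flat data, `ψ⁴`-form in dimension three**:
for `G = ψ⁴ δ` (`ψ` smooth and non-vanishing on `V`), `K` differentiable at `x ∈ V` with `K_x`
symmetric, and an orthonormal basis `b` of the `3`-dimensional space,
`M(Z) = ψ⁻⁴ ( Σₖ ∂_{bₖ}K(bₖ, Z) − ∂_Z Σᵢ K(bᵢ,bᵢ) + 2ψ⁻¹ K(∇ψ, Z) + 2ψ⁻¹ ∂_Zψ · Σᵢ K(bᵢ,bᵢ) )`,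
where `∇ψ = ♯dψ` (`θ = 2 dψ/ψ`, `T = 2 ∇ψ/ψ`). Bartnik–Isenberg 2004, §4.1.
[cite: BartnikIsenberg2004, §4.1] -/
theorem momFn_conformal_fourth_power_innerSL (hV : IsOpen V) {ψ : E → ℝ}
    (hψ : ContDiffOn ℝ ∞ ψ V) (hψ0 : ∀ y ∈ V, ψ y ≠ 0) (hx : x ∈ V) (b : Module.Basis (Fin 3) ℝ E)
    (hb : Orthonormal ℝ b) {K : E → E →L[ℝ] E →L[ℝ] ℝ} (hK : DifferentiableAt ℝ K x)
    (hKs : ∀ v w, K x v w = K x w v) (Z : E) :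
    momFn b (fun y ↦ ψ y ^ 4 • (innerSL ℝ : E →L[ℝ] E →L[ℝ] ℝ)) K x Z =
      (ψ x ^ 4)⁻¹ * ((∑ k, fderiv ℝ K x (b k) (b k) Z - ∑ i, fderiv ℝ K x Z (b i) (b i))
        + 2 * (ψ x)⁻¹ * K x (sharpAt (fun _ : E ↦ innerSL ℝ) x (fderiv ℝ ψ x)) Z
        + 2 * (ψ x)⁻¹ * fderiv ℝ ψ x Z * ∑ i, K x (b i) (b i)) := by
  have hc : ContDiffOn ℝ ∞ (fun z ↦ ψ z ^ 4) V := hψ.pow 4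
  have hc0 : ∀ y ∈ V, ψ y ^ 4 ≠ 0 := fun y hy ↦ pow_ne_zero 4 (hψ0 y hy)
  have hψx := hψ0 x hx
  have hψd : DifferentiableAt ℝ ψ x :=
    ((hψ x hx).contDiffAt (hV.mem_nhds hx)).differentiableAt (by simp)
  rw [momFn_conformal_innerSL hV hc hc0 hx b hb hK hKs Z, confVec,
    confForm_fourth_power hψd hψx, map_smul, map_smul, _root_.smul_apply,
    _root_.smul_apply, Fintype.card_fin]
  simp only [smul_eq_mul, Nat.cast_ofNat]
  ring

/-! ### The Hamiltonian constraint density -/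

/-- **The Hamiltonian constraint density of conformally flat data in dimension three**: for
`G = ψ⁴ δ` (`ψ` smooth and non-vanishing on `V`), any field `K` of bilinear forms, and an
orthonormal basis `b` of the `3`-dimensional space,
`H = −8 ψ⁻⁵ Δψ − ψ⁻⁸ Σᵢⱼ K(bᵢ,bⱼ)² + ψ⁻⁸ (Σᵢ K(bᵢ,bᵢ))²`, `Δψ = Σₖ ∂ₖ∂ₖ ψ`
(`R(ψ⁴δ) = −8ψ⁻⁵Δψ`, Schoen–Yau 1979, p. 49; Bartnik–Isenberg 2004, (2.1) with §4.1).
[cite: SchoenYauPMT1979, §2 Step 1 (p. 49)] -/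
theorem hamAt_conformal_fourth_power_innerSL (hV : IsOpen V) {ψ : E → ℝ}
    (hψ : ContDiffOn ℝ ∞ ψ V) (hψ0 : ∀ y ∈ V, ψ y ≠ 0) (hx : x ∈ V) (b : Module.Basis (Fin 3) ℝ E)
    (hb : Orthonormal ℝ b) (h3 : Module.finrank ℝ E = 3) (K : E → E →L[ℝ] E →L[ℝ] ℝ) :
    hamAt (fun y ↦ ψ y ^ 4 • (innerSL ℝ : E →L[ℝ] E →L[ℝ] ℝ)) K x =
      -8 * (ψ x ^ 5)⁻¹ * ∑ k, fderiv ℝ (fderiv ℝ ψ) x (b k) (b k)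
        - (ψ x ^ 8)⁻¹ * ∑ i, ∑ j, K x (b i) (b j) ^ 2
        + (ψ x ^ 8)⁻¹ * (∑ i, K x (b i) (b i)) ^ 2 := by
  have hc : ContDiffOn ℝ ∞ (fun z ↦ ψ z ^ 4) V := hψ.pow 4
  have hc0 : ∀ y ∈ V, ψ y ^ 4 ≠ 0 := fun y hy ↦ pow_ne_zero 4 (hψ0 y hy)
  have hψx := hψ0 x hx
  rw [hamAt_eq, (isMetricOn_innerSL hV).scalAt_conformal_fourth_power hψ hψ0 hx h3,
    scalAt_innerSL, lapAt_innerSL b hb, normSqAt_conformal_innerSL hV hc hc0 hx b hb (K x),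
    mtrAt_conformal_innerSL hV hc hc0 hx b hb]
  have h8 : ψ x ^ 8 ≠ 0 := pow_ne_zero 8 hψx
  have h5 : ψ x ^ 5 ≠ 0 := pow_ne_zero 5 hψx
  have h4 : ψ x ^ 4 ≠ 0 := pow_ne_zero 4 hψx
  field_simp
  ring

end Conformal

end MetricCoord

end Literature.Geometry.Lorentzian

end
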